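import Literature.Computability.AlgebraicComplexity.BI17FundamentalInvariantForms
import Literature.Computability.AlgebraicComplexity.OrbitClosureWeights
import Literature.Computability.AlgebraicComplexity.StandardFamiliesProofs
import Mathlib.Topology.Algebra.MvPolynomial
import Mathlib.Analysis.SpecialFunctions.Exp
import HarnessLib

/-!
# Instability of forms from a separating torus weight (elementary Hilbert–Mumford direction)

P. Bürgisser, C. Ikenmeyer, *Fundamental invariants of orbit closures*, J. Algebra **477** (2017)
390–434 = arXiv:1511.02927 [BurgisserIkenmeyer2017], §2.2, proof of Prop. 2.8 (held text
`paper:arxiv-1511.02927` p0007:L1–30): for a diagonal one-parameter subgroup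
`σ(t) = diag(t^{μ_1}, …, t^{μ_m})` of `SL_m` (`∑ μ_i = 0`),
"`σ(t) w = ∑_α t^{⟨α, μ⟩} w_α X^α`, where `⟨α, μ⟩ := ∑_i α_i μ_i`. The existence of
`lim_{t → 0} σ(t) w` implies that `⟨α, μ⟩ ≥ 0` for all `α ∈ supp(w)`."

This file proves the ELEMENTARY direction of the Hilbert–Mumford criterion for the diagonal torus
that this display encodes, as a tool complementary to the (corrected) polystability criterion
`BI17FormPolystabilityCriterion.lean`: if some traceless real weight `μ` is POSITIVE on the whole
support of a nonzero form `f` — equivalently (Farkas), `(1,…,1)` is NOT in the convex cone of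
`supp(f)` — then `diag(e^{-sμ}) · f → 0` (`s → ∞`), so the zero form lies in the closure of the
`SL`-orbit, hence in its Zariski closure (`closure_subset_zariskiClosure`, polynomials are
continuous), and `f` is not polystable (`not_isPolystable_of_posWeight`). Examples:
`X_0^D` in `m ≥ 2` variables (`not_isPolystable_X_pow`); any nonzero form without constant term
missing a variable (`not_isPolystable_of_not_mem_vars`); in particular **the padded permanent
`X₀₀^{m−n} per_n`, `n < m`, `m ≥ 2`, is not polystable** (`not_isPolystable_paddedPerPoly`) — the
reason GCT compares orbit closures.

THEOREMS ONLY (no definitions, no named facts). Cell `val-lit`, row BI2017-A (tooling around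
erratum A31). Honest framing: textbook GIT bookkeeping; VP ≠ VNP is NOT proved and nothing here
bears on it.

## References

* [BurgisserIkenmeyer2017] P. Bürgisser, C. Ikenmeyer, *Fundamental invariants of orbit closures*,
  J. Algebra 477 (2017) 390–434; arXiv:1511.02927, §2.2 (proof of Prop. 2.8).
* D. Mumford, J. Fogarty, F. Kirwan, *Geometric Invariant Theory*, 3rd ed. (1994), Ch. 2 §1
  (Hilbert–Mumford; the one-parameter-subgroup direction is elementary).
-/

noncomputable section

open Filter MvPolynomial
open scoped Topology

namespace Literature.Computability.AlgebraicComplexity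

section ZariskiVsEuclidean

variable {ι : Type*}

/-- **The classical closure is contained in the Zariski closure** (affine space `ι → ℂ` with the
product topology, any index type): a polynomial vanishing on `S` vanishes on `closure S`, being a
continuous function. [cite: BurgisserIkenmeyer2017, §3.2 (orbit closures: Zariski = Euclidean closure, the easy inclusion)] -/
theorem closure_subset_zariskiClosure (S : Set (ι → ℂ)) : closure S ⊆ zariskiClosure S := by
  intro x hx
  rw [mem_zariskiClosure_iff]
  intro p hp
  have hcont : Continuous fun y : ι → ℂ => aeval y p := by
    have : (fun y : ι → ℂ => aeval y p) = fun y => eval y p := by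
      funext y; rw [aeval_eq_eval]
    rw [this]
    exact MvPolynomial.continuous_eval p
  have hclosed : IsClosed {y : ι → ℂ | aeval y p = 0} := isClosed_eq hcont continuous_const
  exact hclosed.closure_subset_iff.mpr hp hx

end ZariskiVsEuclidean

section Instability

variable {σ : Type*} [Fintype σ] [DecidableEq σ]

/-- Coefficients of a diagonally substituted polynomial: `coeff_α (diag(d) · f) = d^α coeff_α f`.
[folklore] -/
private theorem coeff_linSubst_diagonal' (d : σ → ℂ) (f : MvPolynomial σ ℂ) (α : σ →₀ ℕ) :
    coeff α (linSubst σ ℂ (Matrix.diagonal d) f) = (∏ i, d i ^ α i) * coeff α f := by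
  conv_lhs => rw [f.as_sum]
  rw [map_sum, coeff_sum]
  simp_rw [linSubst_diagonal_monomial, coeff_smul, coeff_monomial, smul_eq_mul]
  rw [Finset.sum_eq_single α]
  · rw [if_pos rfl, Finsupp.prod_fintype _ _ (fun i => pow_zero _)]
  · intro β _ hβ; rw [if_neg hβ, mul_zero]
  · intro hα; rw [MvPolynomial.notMem_support_iff.mp hα, if_pos rfl, mul_zero]

/-- A linear substitution by an `SL` matrix kills only the zero polynomial. [folklore] -/
private theorem linSubst_sl_eq_zero_iff (g : Matrix.SpecialLinearGroup σ ℂ) (f : MvPolynomial σ ℂ) :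
    linSubst σ ℂ (g : Matrix σ σ ℂ) f = 0 ↔ f = 0 := by
  constructor
  · intro h
    have h1 : linSubst σ ℂ ((g⁻¹ * g : Matrix.SpecialLinearGroup σ ℂ) : Matrix σ σ ℂ) f = 0 := by
      rw [Matrix.SpecialLinearGroup.coe_mul, linSubst_mul, AlgHom.comp_apply, h, map_zero]
    rwa [inv_mul_cancel, Matrix.SpecialLinearGroup.coe_one, linSubst_one, AlgHom.id_apply] at h1
  · rintro rfl; rw [map_zero]

/-- **The one-parameter-subgroup computation of BI 2017 §2.2** ("`σ(t) w = ∑_α t^{⟨α,μ⟩} w_α X^α`"),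
real-exponent form: the coefficient vector of `diag(e^{-s μ}) · f` at `α` is
`e^{-s⟨μ,α⟩} · coeff_α f`. [cite: BurgisserIkenmeyer2017, §2.2 (proof of Prop. 2.8, the display)] -/
theorem coeffVec_linSubst_diagonal_exp (f : MvPolynomial σ ℂ) (μ : σ → ℝ) (s : ℝ) (α : σ →₀ ℕ) :
    coeffVec (linSubst σ ℂ (Matrix.diagonal fun i => ((Real.exp (-(s * μ i)) : ℝ) : ℂ)) f) α =
      ((Real.exp (-(s * ∑ i, μ i * (α i : ℝ))) : ℝ) : ℂ) * coeff α f := by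
  rw [coeffVec_apply, coeff_linSubst_diagonal']
  congr 1
  simp_rw [← Complex.ofReal_pow, ← Real.exp_nat_mul]
  rw [← Complex.ofReal_prod, ← Real.exp_sum]
  congr 2
  rw [Finset.mul_sum, ← Finset.sum_neg_distrib]
  exact Finset.sum_congr rfl fun i _ => by ring

/-- **Instability from a positive traceless weight (elementary direction of Hilbert–Mumford for the
diagonal torus).** If `μ : σ → ℝ` has `∑ μ = 0` and `⟨μ, α⟩ > 0` for every `α ∈ supp(f)`, then the
coefficient vector of the zero form lies in the Zariski closure of the `SL(σ)`-orbit of `f`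
(`diag(e^{-sμ}) ∈ SL` and `diag(e^{-sμ}) · f → 0` as `s → ∞`).
[cite: BurgisserIkenmeyer2017, §2.2 (proof of Prop. 2.8)] -/
theorem coeffVec_zero_mem_zariskiClosure_slOrbit_of_posWeight (f : MvPolynomial σ ℂ) (μ : σ → ℝ)
    (hμ : ∑ i, μ i = 0) (hpos : ∀ α ∈ f.support, 0 < ∑ i, μ i * (α i : ℝ)) :
    coeffVec (0 : MvPolynomial σ ℂ) ∈ zariskiClosure (coeffVec '' slOrbit σ ℂ f) := by
  classical
  refine closure_subset_zariskiClosure _ ?_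
  -- the curve `s ↦ diag(e^{-sμ}) · f` inside the orbit
  set γ : ℝ → (σ →₀ ℕ) → ℂ := fun s =>
    coeffVec (linSubst σ ℂ (Matrix.diagonal fun i => ((Real.exp (-(s * μ i)) : ℝ) : ℂ)) f) with hγ
  have hdet : ∀ s : ℝ, (Matrix.diagonal fun i => ((Real.exp (-(s * μ i)) : ℝ) : ℂ)).det = 1 := by
    intro s
    rw [Matrix.det_diagonal, ← Complex.ofReal_prod, ← Real.exp_sum,
      show ∑ i, -(s * μ i) = -(s * ∑ i, μ i) from by rw [Finset.mul_sum, Finset.sum_neg_distrib],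
      hμ, mul_zero, neg_zero, Real.exp_zero, Complex.ofReal_one]
  have hmem : ∀ s : ℝ, γ s ∈ coeffVec '' slOrbit σ ℂ f := fun s =>
    ⟨_, ⟨⟨_, hdet s⟩, rfl⟩, rfl⟩
  have htends : Tendsto γ atTop (𝓝 (coeffVec (0 : MvPolynomial σ ℂ))) := by
    rw [tendsto_pi_nhds]
    intro α
    simp only [hγ, coeffVec_linSubst_diagonal_exp]
    rw [coeffVec_apply, coeff_zero]
    by_cases hα : α ∈ f.support
    · have h1 : Tendsto (fun s : ℝ => Real.exp (-(s * ∑ i, μ i * (α i : ℝ)))) atTop (𝓝 0) := by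
        refine Real.tendsto_exp_atBot.comp ?_
        rw [show (fun s : ℝ => -(s * ∑ i, μ i * (α i : ℝ))) =
            fun s => s * (-(∑ i, μ i * (α i : ℝ))) from funext fun s => by ring]
        exact tendsto_id.atTop_mul_const_of_neg (neg_neg_of_pos (hpos α hα))
      have h2 : Tendsto (fun s : ℝ => ((Real.exp (-(s * ∑ i, μ i * (α i : ℝ))) : ℝ) : ℂ))
          atTop (𝓝 0) := by
        rw [show (0 : ℂ) = ((0 : ℝ) : ℂ) from Complex.ofReal_zero.symm]
        exact (Complex.continuous_ofReal.tendsto 0).comp h1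
      simpa using h2.mul_const (coeff α f)
    · rw [MvPolynomial.notMem_support_iff.mp hα]
      simp
  exact mem_closure_of_tendsto htends (Eventually.of_forall hmem)

/-- **A nonzero form with a positive separating weight is NOT polystable** (its `SL`-orbit has the
zero form in its Zariski closure but not in the orbit). Equivalently (Farkas): if `(1,…,1)` is not
in the convex cone of `supp(f)` then `f ≠ 0` is unstable — the necessity of hypothesis 2 in BI 2017
Prop. 2.8. [cite: BurgisserIkenmeyer2017, §2.2 (proof of Prop. 2.8)] -/
theorem not_isPolystable_of_posWeight (f : MvPolynomial σ ℂ) (hf : f ≠ 0) (μ : σ → ℝ)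
    (hμ : ∑ i, μ i = 0) (hpos : ∀ α ∈ f.support, 0 < ∑ i, μ i * (α i : ℝ)) :
    ¬ IsPolystable f := by
  intro hps
  have h0 := hps (coeffVec_zero_mem_zariskiClosure_slOrbit_of_posWeight f μ hμ hpos)
  obtain ⟨h, ⟨g, rfl⟩, hh⟩ := h0
  have hzero : linSubst σ ℂ (g : Matrix σ σ ℂ) f = 0 := by
    ext α
    have := congr_fun hh α
    rwa [coeffVec_apply, coeffVec_apply, coeff_zero] at this
  exact hf ((linSubst_sl_eq_zero_iff g f).mp hzero)

/-- **Example: `X_0^D` (`D ≥ 1`) in `m ≥ 2` variables is not polystable** — the weight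
`μ = e_0 − e_1` is traceless and positive on `supp(X_0^D) = {D e_0}`.
[cite: BurgisserIkenmeyer2017, §2.2 (proof of Prop. 2.8)] -/
theorem not_isPolystable_X_pow {m : ℕ} (hm : 2 ≤ m) {D : ℕ} (hD : 1 ≤ D) :
    ¬ IsPolystable (X (⟨0, by omega⟩ : Fin m) ^ D : MvPolynomial (Fin m) ℂ) := by
  classical
  set i₀ : Fin m := ⟨0, by omega⟩ with hi₀
  set i₁ : Fin m := ⟨1, by omega⟩ with hi₁
  have h01 : i₀ ≠ i₁ := by simp [hi₀, hi₁, Fin.ext_iff]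
  have hX : (X i₀ ^ D : MvPolynomial (Fin m) ℂ) = monomial (Finsupp.single i₀ D) 1 := by
    rw [X_pow_eq_monomial]
  refine not_isPolystable_of_posWeight _ ?_
    (fun i => if i = i₀ then 1 else if i = i₁ then -1 else 0) ?_ ?_
  · rw [hX]; exact monomial_eq_zero.not.mpr one_ne_zero
  · rw [← Finset.add_sum_erase _ _ (Finset.mem_univ i₀), if_pos rfl,
      ← Finset.add_sum_erase _ _ (Finset.mem_erase.mpr ⟨h01.symm, Finset.mem_univ i₁⟩),
      if_neg h01.symm, if_pos rfl, Finset.sum_eq_zero fun i hi => ?_]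
    · ring
    · rw [if_neg (Finset.ne_of_mem_erase (Finset.mem_of_mem_erase hi)),
        if_neg (Finset.ne_of_mem_erase hi)]
  · intro α hα
    rw [hX, support_monomial, if_neg one_ne_zero, Finset.mem_singleton] at hα
    subst hα
    simp only [Finsupp.single_apply]
    rw [Finset.sum_eq_single i₀]
    · simp only [if_true, one_mul]
      exact_mod_cast hD
    · intro i _ hi
      rw [if_neg (Ne.symm hi)]
      simp
    · intro h; exact absurd (Finset.mem_univ _) h

/-- **Forms missing a variable are not polystable.** If `f ≠ 0` has no constant term and some
variable `X_i` does not occur in `f`, then `f` is not polystable: the traceless weight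
`μ = 𝟙 − |σ|·e_i` has `⟨μ, α⟩ = |α| > 0` on `supp(f)` (`not_isPolystable_of_posWeight`). (Forms in
fewer than all the variables lie in the null cone — the reason GCT works with orbit CLOSURES of
padded polynomials.) [cite: BurgisserIkenmeyer2017, §2.2 (proof of Prop. 2.8; one-parameter subgroups)] -/
theorem not_isPolystable_of_not_mem_vars (f : MvPolynomial σ ℂ) (hf : f ≠ 0)
    (h0 : ∀ α ∈ f.support, α ≠ 0) (i : σ) (hi : i ∉ f.vars) : ¬ IsPolystable f := by
  classical
  refine not_isPolystable_of_posWeight f hf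
    (fun j => if j = i then 1 - (Fintype.card σ : ℝ) else 1) ?_ ?_
  · rw [Finset.sum_ite, Finset.sum_const, Finset.sum_const, nsmul_eq_mul, nsmul_eq_mul]
    have h1 : (Finset.univ.filter fun j : σ => j = i).card = 1 := by
      rw [Finset.filter_eq', if_pos (Finset.mem_univ i), Finset.card_singleton]
    have h2 : ((Finset.univ.filter fun j : σ => ¬ j = i).card : ℝ) = Fintype.card σ - 1 := by
      rw [Finset.filter_ne', Finset.card_erase_of_mem (Finset.mem_univ i), Finset.card_univ,
        Nat.cast_sub (Fintype.card_pos_iff.mpr ⟨i⟩), Nat.cast_one]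
    rw [h1, h2]
    push_cast
    ring
  · intro α hα
    have hαi : α i = 0 := by
      by_contra hne
      exact hi ((mem_vars_iff_mem_support i).mpr ⟨α, hα, Finsupp.mem_support_iff.mpr hne⟩)
    have hsum : ∑ j, (if j = i then 1 - (Fintype.card σ : ℝ) else 1) * (α j : ℝ) =
        ∑ j, (α j : ℝ) := by
      refine Finset.sum_congr rfl fun j _ => ?_
      by_cases hj : j = i
      · subst hj; rw [hαi]; simp
      · rw [if_neg hj, one_mul]
    rw [hsum]
    have hne : α ≠ 0 := h0 α hα
    obtain ⟨j, hj⟩ := Finsupp.ne_iff.mp hne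
    have hjpos : (0 : ℝ) < α j := by
      have : 0 < α j := Nat.pos_of_ne_zero (by simpa using hj)
      exact_mod_cast this
    exact lt_of_lt_of_le hjpos (Finset.single_le_sum (f := fun l => (α l : ℝ))
      (fun l _ => by positivity) (Finset.mem_univ j))

/-- The padded permanent is nonzero (private copy of the tree's `paddedPerPoly_ne_zero`, whose home
file imports all of Mathlib). [folklore] -/
private theorem paddedPerPoly_ne_zero' (n m : ℕ) [NeZero m] : paddedPerPoly ℂ n m ≠ 0 := by
  have hinj : Function.Injective
      (fun ij : BlockIdx n m × BlockIdx n m => ((ij.1 : Fin m), (ij.2 : Fin m))) := by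
    intro a b h
    simp only [Prod.mk.injEq] at h
    exact Prod.ext (Subtype.ext h.1) (Subtype.ext h.2)
  have hper : rename (fun ij : BlockIdx n m × BlockIdx n m => ((ij.1 : Fin m), (ij.2 : Fin m)))
      (perPoly (BlockIdx n m) ℂ) ≠ 0 := by
    intro h
    apply perPoly_ne_zero (BlockIdx n m) ℂ
    exact rename_injective _ hinj (by rw [h, map_zero])
  unfold paddedPerPoly
  exact mul_ne_zero (pow_ne_zero _ (X_ne_zero _)) hper

/-- **The padded permanent `X₀₀^{m−n} · per_n` (`n < m`, `2 ≤ m`) is NOT polystable**: it does not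
involve the variable `X₀₁` (row `0` carries only the padding variable, the permanent sits in the
rows `≥ m − n ≥ 1`), so it lies in the null cone by `not_isPolystable_of_not_mem_vars`. This is why
the GCT programme (Mulmuley–Sohoni 2001 §4; Bürgisser–Ikenmeyer–Panova 2019 §1) compares orbit
CLOSURES, not orbits, of the padded permanent and the determinant.
[cite: MulmuleySohoni2001, §4 (padded permanent); BurgisserIkenmeyer2017, §2.2 (one-parameter subgroups)] -/
theorem not_isPolystable_paddedPerPoly {n m : ℕ} [NeZero m] (hnm : n < m) (hm : 2 ≤ m) :
    ¬ IsPolystable (paddedPerPoly ℂ n m) := by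
  classical
  have hhom := paddedPerPoly_isHomogeneous (k := ℂ) hnm.le
  refine not_isPolystable_of_not_mem_vars _ (paddedPerPoly_ne_zero' n m) ?_
    ((0 : Fin m), (⟨1, hm⟩ : Fin m)) ?_
  · intro α hα h0
    have hdeg := hhom (mem_support_iff.mp hα)
    rw [h0] at hdeg
    simp only [Finsupp.weight_apply, Finsupp.sum_zero_index] at hdeg
    exact (NeZero.ne m) hdeg.symm
  · unfold paddedPerPoly
    intro hv
    have hv' := vars_mul _ _ hv
    rw [Finset.mem_union] at hv'
    rcases hv' with h1 | h2
    · have h1' := vars_pow _ _ h1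
      rw [vars_X, Finset.mem_singleton, Prod.mk.injEq] at h1'
      exact absurd h1'.2 (by simp [Fin.ext_iff])
    · have h2' := vars_rename _ _ h2
      rw [Finset.mem_image] at h2'
      obtain ⟨ij, _, hij⟩ := h2'
      have hrow : m - n ≤ ((ij.1 : BlockIdx n m) : Fin m).val := ij.1.2
      have h00 : ((ij.1 : BlockIdx n m) : Fin m) = (0 : Fin m) := (Prod.mk.inj hij).1
      rw [h00] at hrow
      simp only [Fin.val_zero] at hrow
      omega

end Instability

end Literature.Computability.AlgebraicComplexity
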